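import Literature.MathematicalPhysics.QuantumLattice.PairWordConnectedCoeffBound
import Literature.Analysis.Complex.ExpRecursionPowerSeries
import HarnessLib

/-!
# Finite-temperature perturbation theory in several pair-monomial couplings converges uniformly in the volume

Topic `MathematicalPhysics/QuantumLattice`; the generic single-scale theorem of the word expansion
(`PairWordDysonSeries` → `PairWordLinkedCluster` → `PairWordConnectedCoeffBound`), companion of
`HubbardTorusSingleScalePressure.lean` / `DWaveSourceTorusSingleScalePressure.lean` (on-site quartic
vertex only). Setting: a Hermitian one-body matrix `h` on finitely many orbitals, `β ≥ 0`, letters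
`(t, x) ∈ T × Λ` (vertex type × site) each a monomial of `p` pairs `W_{(t,x)} = ∏_{q<p} c†_{op} c_{om}`,
weights `|v (t, x)| ≤ w t`, sites identified with a finite abelian group `Λ'`, and an even
translation-invariant line bound `γ` on the chronological word propagator matrices (`hG`). With
`W ≥ Σ_t w_t`, `Γ ≥ Σ_z γ z` and

`ϱ = e β W 2^p (2p²Γ + 1)`,

PROVED here:

* `summable_norm_wordIntegrand`, `orderedIntegral_wordIntegrand_zero` — the Dyson series is entire, `b₀ = Z₀`;
* `word_coeff_bound_algebra`, `norm_wordConnectedCoeffOn_le_geometric` — the geometric form of the bound,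
  also for restricted word sums (coefficient extraction);
* **`pairWord_connectedCoeff_bound_and_exp`** — (i) `‖c_j‖ ≤ |Λ'| (2p²Γ+1)⁻¹ ϱ^j` for `j ≥ 1`
  (`c_j = ∫_{Δ_j}` `wordUrsellIntegrand`); (ii) for complex `ϱ|z| < 1` the Dyson series of
  `Tr e^{-β(dΓ(h) + z Σ_r v_r W_r)}` resums to `Z₀ exp(Σ_j c_j z^j)`
  (`word_linkedCluster_recursion` + `tsum_eq_mul_exp_tsum_of_recursion`);
* **`partitionFn_pairWord_eq_exp_connected`** — hence
  `Tr e^{-β(dΓ(h) + z Σ_r v_r W_r)} = Z₀ · exp(Σ_{j≥1} c_j z^j)` on `ϱ|z| < 1`, with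
  `|Σ_j c_j z^j| ≤ |Λ'| (2p²Γ+1)⁻¹ Σ_j (ϱ|z|)^j`: `log Z` is analytic in the coupling and extensive, uniformly in
  every parameter entering only through `W`, `Γ` (the volume, sources inside the letters, …).

Since the couplings of the individual vertex types sit in the weights `v`, this is JOINT analyticity in
all of them (ray `z ↦ z·v`): the fixed-temperature layer of the mixed (counterterm / source / interaction)
expansions of Benfatto–Giuliani–Mastropietro 2006 §2 at a single scale (radius `∝ T`).
Everything is PROVED; no definition and no named fact.

## References
* G. Benfatto, A. Giuliani, V. Mastropietro, Ann. Henri Poincaré 7 (2006) 809–898, §2.1–2.2, (2.77).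
  [cite: BenfattoGiulianiMastropietro2006, (2.77)]
* D. C. Brydges, *A short course on cluster expansions*, Les Houches 1984, §2. [cite: Brydges1986, §2]
* W. de Siqueira Pedra, M. Salmhofer, Comm. Math. Phys. 282 (2008) 797–818, Thm 2.4. [cite: PedraSalmhofer2008, Thm 2.4]
-/

noncomputable section

open scoped Matrix.Norms.L2Operator ComplexOrder
open Finset MeasureTheory Filter Topology NormedSpace Set
open Literature.Probability.LatticeModels

namespace Literature.MathematicalPhysics.QuantumLattice

/-! ### The Dyson series is entire; its constant term -/

section Summable

variable {κ : Type*} [LinearOrder κ] [Fintype κ] (β : ℝ) (h : Matrix κ κ ℂ)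
variable {R : Type*} [Fintype R] {p : ℕ} (op om : R → Fin p → κ) (v : R → ℂ)

/-- **The Dyson series of the word expansion converges absolutely for every coupling** (finite volume).
[cite: BenfattoGiulianiMastropietro2006, §2.1 (2.6)] -/
theorem summable_norm_wordIntegrand (hh : h.IsHermitian) (g : ℂ) :
    Summable fun m : ℕ => ‖g ^ m *
      orderedIntegral m (wordIntegrand β h op om v (Matrix.partitionFn β (dGamma h)) m) 1‖ := by
  haveI : Nonempty (Finset κ) := ⟨∅⟩
  have hZ : Matrix.partitionFn β (dGamma h) ≠ 0 := (Matrix.partitionFn_pos β (isHermitian_dGamma hh)).ne'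
  have hs := summable_norm_dyson_trace_gibbsWeight_sum β (dGamma h) 1 v (fun r => pairWord op om r) g
  simp only [Matrix.one_mul] at hs
  refine hs.congr fun m => ?_
  refine congrArg (fun F => ‖g ^ m * orderedIntegral m F 1‖) (funext fun u => ?_)
  unfold wordIntegrand
  refine congrArg (fun S => (-(β : ℂ)) ^ m * S) (Finset.sum_congr rfl fun f _ => ?_)
  congr 1
  rw [← gibbsState_dGamma_prod_pairWord_evolved_eq_det op om hh β f
    (fun i : Fin m => ((u i : ℝ) : ℂ) * -(β : ℂ)), Matrix.gibbsState_apply, mul_inv_cancel_left₀ hZ]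

/-- The constant term of the Dyson series is `Z₀`. [folklore] -/
theorem orderedIntegral_wordIntegrand_zero (Z₀ : ℂ) :
    orderedIntegral 0 (wordIntegrand β h op om v Z₀ 0) 1 = Z₀ := by
  unfold wordIntegrand
  rw [orderedIntegral_zero, pow_zero, one_mul, Fintype.sum_unique]
  haveI : IsEmpty (Fin (0 * p)) := by rw [Nat.zero_mul]; infer_instance
  rw [Matrix.det_isEmpty, mul_one, Fintype.prod_empty, one_mul]

end Summable

/-! ### The single-scale theorem -/

section Main

variable {κ : Type*} [LinearOrder κ] [Fintype κ] (β : ℝ) (h : Matrix κ κ ℂ)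
variable {T : Type*} [Fintype T] [DecidableEq T] {Λ : Type*} [Fintype Λ] {p : ℕ}
variable (op om : T × Λ → Fin p → κ) (v : T × Λ → ℂ)
variable {Λ' : Type*} [AddCommGroup Λ'] [Fintype Λ'] [DecidableEq Λ']

/-- The arithmetic of the single-scale radius: with `G = 2p²Γ + 1` and `ϱ = e β W 2^p G`,
`|Λ'| (β^j/j!) (Σw)^j j^{j-2} 2^{jp} (2p²Σγ)^{j-1} ≤ |Λ'| G⁻¹ ϱ^j` for `j ≥ 1`, `Σw ≤ W`, `Σγ ≤ Γ`
(`j^{j-2}/j! ≤ e^j`). [folklore] -/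
theorem word_coeff_bound_algebra {β : ℝ} (hβ : 0 ≤ β) {Sw W : ℝ} (hSw0 : 0 ≤ Sw) (hW : Sw ≤ W)
    {Sγ Γ : ℝ} (hSγ0 : 0 ≤ Sγ) (hΓ : Sγ ≤ Γ) (p : ℕ) {j : ℕ} (hj : 1 ≤ j) {c : ℝ} (hc : 0 ≤ c) :
    c * (β ^ j / j.factorial) * (Sw ^ j *
        ((j : ℝ) ^ (j - 2) * ((2 : ℝ) ^ (j * p) * (2 * (p : ℝ) ^ 2 * Sγ) ^ (j - 1)))) ≤
      c * (2 * (p : ℝ) ^ 2 * Γ + 1)⁻¹ * (Real.exp 1 * β * W * 2 ^ p * (2 * (p : ℝ) ^ 2 * Γ + 1)) ^ j := by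
  have hW0 : 0 ≤ W := hSw0.trans hW
  have hΓ0 : 0 ≤ Γ := hSγ0.trans hΓ
  set G : ℝ := 2 * (p : ℝ) ^ 2 * Γ + 1 with hGdef
  have hGpos : 0 < G := by positivity
  have hjR : (1 : ℝ) ≤ j := by exact_mod_cast hj
  have hfact : (j : ℝ) ^ (j - 2) / j.factorial ≤ Real.exp 1 ^ j := by
    calc (j : ℝ) ^ (j - 2) / j.factorial ≤ (j : ℝ) ^ j / j.factorial :=
          div_le_div_of_nonneg_right (pow_le_pow_right₀ hjR (Nat.sub_le j 2)) (by positivity)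
      _ ≤ Real.exp j := Real.pow_div_factorial_le_exp (x := (j : ℝ)) (by positivity) j
      _ = Real.exp 1 ^ j := by rw [← Real.exp_nat_mul, mul_one]
  have h2p : (2 : ℝ) ^ (j * p) = (2 ^ p) ^ j := by rw [mul_comm, pow_mul]
  have hGne : G ≠ 0 := hGpos.ne'
  have hline : (2 * (p : ℝ) ^ 2 * Sγ) ^ (j - 1) ≤ G ^ j * G⁻¹ := by
    have h1 : (2 * (p : ℝ) ^ 2 * Sγ) ^ (j - 1) ≤ G ^ (j - 1) :=
      pow_le_pow_left₀ (by positivity) (by rw [hGdef]; nlinarith [sq_nonneg (p : ℝ)]) _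
    have h2 : G ^ (j - 1) = G ^ j * G⁻¹ := by
      rw [eq_mul_inv_iff_mul_eq₀ hGne, ← pow_succ, Nat.sub_add_cancel hj]
    rw [← h2]; exact h1
  have hwW : Sw ^ j ≤ W ^ j := pow_le_pow_left₀ hSw0 hW _
  calc c * (β ^ j / j.factorial) * (Sw ^ j *
          ((j : ℝ) ^ (j - 2) * ((2 : ℝ) ^ (j * p) * (2 * (p : ℝ) ^ 2 * Sγ) ^ (j - 1))))
      = c * (((j : ℝ) ^ (j - 2) / j.factorial) * (β ^ j * (2 ^ p) ^ j) * Sw ^ j *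
          (2 * (p : ℝ) ^ 2 * Sγ) ^ (j - 1)) := by
        rw [h2p]; ring
    _ ≤ c * (Real.exp 1 ^ j * (β ^ j * (2 ^ p) ^ j) * W ^ j * (G ^ j * G⁻¹)) := by
        gcongr
    _ = c * G⁻¹ * (Real.exp 1 * β * W * 2 ^ p * G) ^ j := by
        simp only [mul_pow]
        ring

/-- **The single-scale bound on the connected coefficients of the word expansion and the exponential
resummation, uniformly in every parameter entering through `W ≥ Σ_t w_t` and `Γ ≥ Σ_z γ z`.** With
`ϱ = e β W 2^p (2p²Γ+1)`: (i) `‖c_j‖ ≤ |Λ'| (2p²Γ+1)⁻¹ ϱ^j` for `j ≥ 1`; (ii) for complex `ϱ|z| < 1`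
the Dyson series of `Tr e^{-β(dΓ(h) + z Σ_r v_r W_r)}` resums to `Z₀ exp(Σ_j c_j z^j)`.
[cite: BenfattoGiulianiMastropietro2006, (2.77)] -/
theorem pairWord_connectedCoeff_bound_and_exp (hh : h.IsHermitian) (hβ : 0 ≤ β) (pos : Λ ≃ Λ')
    (w : T → ℝ) (hw0 : ∀ s, 0 ≤ w s) (hw : ∀ s x, ‖v (s, x)‖ ≤ w s) (W : ℝ) (hW : ∑ s, w s ≤ W)
    (γ : Λ' → ℝ) (hγ0 : ∀ z, 0 ≤ γ z) (hγ : ∀ z, γ (-z) = γ z) (Γ : ℝ) (hΓ : ∑ z, γ z ≤ Γ)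
    (hG : ∀ (j : ℕ) (u : Fin j → ℝ), Monotone u → (∀ i, u i ∈ Icc (0 : ℝ) 1) →
      ∀ (t : Fin j → T) (g : Fin j → Λ) (a b : Fin (j * p)),
        ‖wordPropMatrix β h op om (fun i => (t i, g i)) (fun i => ((u i : ℝ) : ℂ) * -(β : ℂ)) a b‖ ≤
          γ (pos (g (wordCluster p j a)) - pos (g (wordCluster p j b)))) :
    (∀ j : ℕ, 1 ≤ j → ‖orderedIntegral j (wordUrsellIntegrand β h op om v j) 1‖ ≤
        (Fintype.card Λ' : ℝ) * (2 * (p : ℝ) ^ 2 * Γ + 1)⁻¹ *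
          (Real.exp 1 * β * W * 2 ^ p * (2 * (p : ℝ) ^ 2 * Γ + 1)) ^ j) ∧
    ∀ z : ℂ, (Real.exp 1 * β * W * 2 ^ p * (2 * (p : ℝ) ^ 2 * Γ + 1)) * ‖z‖ < 1 →
      HasSum (fun m : ℕ => z ^ m *
          orderedIntegral m (wordIntegrand β h op om v (Matrix.partitionFn β (dGamma h)) m) 1)
        (Matrix.partitionFn β (dGamma h) *
          Complex.exp (∑' j : ℕ, (if j = 0 then 0 else
            orderedIntegral j (wordUrsellIntegrand β h op om v j) 1) * z ^ j)) := by
  classical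
  have hsumw0 : 0 ≤ ∑ s, w s := sum_nonneg fun s _ => hw0 s
  have hW0 : 0 ≤ W := hsumw0.trans hW
  have hsumγ0 : 0 ≤ ∑ z, γ z := sum_nonneg fun z _ => hγ0 z
  have hΓ0 : 0 ≤ Γ := hsumγ0.trans hΓ
  set G : ℝ := 2 * (p : ℝ) ^ 2 * Γ + 1 with hGdef
  have hGpos : 0 < G := by positivity
  set ϱ : ℝ := Real.exp 1 * β * W * 2 ^ p * G with hϱ
  have hϱ0 : 0 ≤ ϱ := by positivity
  -- (i) the geometric bound on the connected coefficients
  have hcoef : ∀ j : ℕ, 1 ≤ j → ‖orderedIntegral j (wordUrsellIntegrand β h op om v j) 1‖ ≤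
      (Fintype.card Λ' : ℝ) * G⁻¹ * ϱ ^ j := fun j hj =>
    (norm_wordConnectedCoeff_le β h op om hh hβ pos γ hγ0 hγ v w hw0 hw hj (hG j)).trans
      (word_coeff_bound_algebra hβ hsumw0 hW hsumγ0 hΓ p hj (by positivity))
  refine ⟨hcoef, fun z hz => ?_⟩
  -- (ii) the exponential resummation, on the disc of radius `R` (`= ϱ⁻¹`, or any radius if `ϱ = 0`)
  set R : ℝ := if ϱ = 0 then ‖z‖ + 1 else ϱ⁻¹ with hR
  have hzR : ‖z‖ < R := by
    by_cases hϱz : ϱ = 0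
    · rw [hR, if_pos hϱz]; linarith
    · rw [hR, if_neg hϱz]
      have hϱpos : 0 < ϱ := lt_of_le_of_ne hϱ0 (Ne.symm hϱz)
      rw [← one_div, lt_div_iff₀ hϱpos, mul_comm]
      exact hz
  have hrq : ∀ r : ℝ, 0 ≤ r → r < R → r * ϱ < 1 := by
    intro r hr hrR
    by_cases hϱz : ϱ = 0
    · rw [hϱz, mul_zero]; exact zero_lt_one
    · rw [hR, if_neg hϱz] at hrR
      have hϱpos : 0 < ϱ := lt_of_le_of_ne hϱ0 (Ne.symm hϱz)
      have := mul_lt_mul_of_pos_right hrR hϱpos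
      rwa [inv_mul_cancel₀ hϱpos.ne'] at this
  have hbsum : ∀ r : ℝ, 0 ≤ r → r < R →
      Summable fun k => ‖orderedIntegral k
        (wordIntegrand β h op om v (Matrix.partitionFn β (dGamma h)) k) 1‖ * r ^ k := by
    intro r hr _
    refine (summable_norm_wordIntegrand β h op om v hh r).congr fun k => ?_
    rw [norm_mul, norm_pow, Complex.norm_real, Real.norm_of_nonneg hr, mul_comm]
  have hcsum : ∀ r : ℝ, 0 ≤ r → r < R → Summable fun j : ℕ =>
      ‖(if j = 0 then 0 else orderedIntegral j (wordUrsellIntegrand β h op om v j) 1)‖ * r ^ j := by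
    intro r hr hrR
    have hq : r * ϱ < 1 := hrq r hr hrR
    have hgeo : Summable fun j : ℕ => (Fintype.card Λ' : ℝ) * G⁻¹ * (r * ϱ) ^ j :=
      (summable_geometric_of_lt_one (by positivity) hq).mul_left _
    refine Summable.of_nonneg_of_le (fun j => by positivity) (fun j => ?_) hgeo
    by_cases hj0 : j = 0
    · subst hj0
      simp only [if_true, norm_zero, pow_zero, mul_one]
      positivity
    · have hj : 1 ≤ j := Nat.one_le_iff_ne_zero.mpr hj0
      rw [if_neg hj0]
      calc _ ≤ (Fintype.card Λ' : ℝ) * G⁻¹ * ϱ ^ j * r ^ j :=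
            mul_le_mul_of_nonneg_right (hcoef j hj) (pow_nonneg hr _)
        _ = (Fintype.card Λ' : ℝ) * G⁻¹ * (r * ϱ) ^ j := by rw [mul_pow r ϱ j]; ring
  have hc0 : ((if (0 : ℕ) = 0 then 0 else
      orderedIntegral 0 (wordUrsellIntegrand β h op om v 0) 1) : ℂ) = 0 := if_pos rfl
  -- the recursion `k b_k = Σ j c_j b_{k-j}` (`PairWordLinkedCluster`)
  have hrec : ∀ k : ℕ, (k : ℂ) * orderedIntegral k
        (wordIntegrand β h op om v (Matrix.partitionFn β (dGamma h)) k) 1 =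
      ∑ q ∈ antidiagonal k, (q.1 : ℂ) *
        (if q.1 = 0 then 0 else orderedIntegral q.1 (wordUrsellIntegrand β h op om v q.1) 1) *
          orderedIntegral q.2 (wordIntegrand β h op om v (Matrix.partitionFn β (dGamma h)) q.2) 1 := by
    intro k
    rw [word_linkedCluster_recursion]
    refine Finset.sum_congr rfl fun q _ => ?_
    by_cases hq : q.1 = 0
    · simp only [hq, Nat.cast_zero, zero_mul]
    · rw [if_neg hq]
  -- `Z = Z(0) e^C` on `|z| < R`
  have key := Literature.Analysis.Complex.tsum_eq_mul_exp_tsum_of_recursion hbsum hcsum hc0 hrec hzR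
  rw [orderedIntegral_wordIntegrand_zero] at key
  have hsU : Summable fun k => orderedIntegral k
      (wordIntegrand β h op om v (Matrix.partitionFn β (dGamma h)) k) 1 * z ^ k := by
    refine Summable.of_norm ?_
    refine (hbsum ‖z‖ (norm_nonneg z) hzR).congr fun k => ?_
    rw [norm_mul, norm_pow]
  have h2 := hsU.hasSum
  rw [key] at h2
  have hfun : (fun m : ℕ => z ^ m * orderedIntegral m
        (wordIntegrand β h op om v (Matrix.partitionFn β (dGamma h)) m) 1) =
      fun m => orderedIntegral m (wordIntegrand β h op om v (Matrix.partitionFn β (dGamma h)) m) 1 * z ^ m :=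
    funext fun m => mul_comm _ _
  rw [hfun]
  exact h2

/-- **Finite-temperature perturbation theory in a family of pair-monomial couplings converges uniformly in
the volume.** Under the hypotheses of `pairWord_connectedCoeff_bound_and_exp`, for every complex `z` with
`ϱ|z| < 1`, `ϱ = e β W 2^p (2p²Γ+1)` (so `z = 1` is allowed once `ϱ < 1`: small couplings at fixed `β`):
`Tr e^{-β(dΓ(h) + z Σ_r v_r W_r)} = Tr e^{-β dΓ(h)} · exp(Σ_{j≥1} c_j z^j)` with
`‖Σ_{j≥1} c_j z^j‖ ≤ |Λ'| (2p²Γ+1)⁻¹ Σ_j (ϱ|z|)^j` — the correction to `log Z` is analytic in the coupling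
and extensive, uniformly in everything that enters only through `W` and `Γ`.
[cite: BenfattoGiulianiMastropietro2006, (2.77)] -/
theorem partitionFn_pairWord_eq_exp_connected (hh : h.IsHermitian) (hβ : 0 ≤ β) (pos : Λ ≃ Λ')
    (w : T → ℝ) (hw0 : ∀ s, 0 ≤ w s) (hw : ∀ s x, ‖v (s, x)‖ ≤ w s) (W : ℝ) (hW : ∑ s, w s ≤ W)
    (γ : Λ' → ℝ) (hγ0 : ∀ z, 0 ≤ γ z) (hγ : ∀ z, γ (-z) = γ z) (Γ : ℝ) (hΓ : ∑ z, γ z ≤ Γ)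
    (hG : ∀ (j : ℕ) (u : Fin j → ℝ), Monotone u → (∀ i, u i ∈ Icc (0 : ℝ) 1) →
      ∀ (t : Fin j → T) (g : Fin j → Λ) (a b : Fin (j * p)),
        ‖wordPropMatrix β h op om (fun i => (t i, g i)) (fun i => ((u i : ℝ) : ℂ) * -(β : ℂ)) a b‖ ≤
          γ (pos (g (wordCluster p j a)) - pos (g (wordCluster p j b))))
    (z : ℂ) (hz : (Real.exp 1 * β * W * 2 ^ p * (2 * (p : ℝ) ^ 2 * Γ + 1)) * ‖z‖ < 1) :
    Matrix.partitionFn β (dGamma h + z • ∑ r, v r • pairWord op om r) =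
      Matrix.partitionFn β (dGamma h) *
        Complex.exp (∑' j : ℕ, (if j = 0 then 0 else
          orderedIntegral j (wordUrsellIntegrand β h op om v j) 1) * z ^ j) ∧
    ‖∑' j : ℕ, (if j = 0 then 0 else orderedIntegral j (wordUrsellIntegrand β h op om v j) 1) * z ^ j‖ ≤
      (Fintype.card Λ' : ℝ) * (2 * (p : ℝ) ^ 2 * Γ + 1)⁻¹ *
        ∑' j : ℕ, ((Real.exp 1 * β * W * 2 ^ p * (2 * (p : ℝ) ^ 2 * Γ + 1)) * ‖z‖) ^ j := by
  obtain ⟨hcoef, hexp⟩ := pairWord_connectedCoeff_bound_and_exp β h op om v hh hβ pos w hw0 hw W hW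
    γ hγ0 hγ Γ hΓ hG
  set ϱ : ℝ := Real.exp 1 * β * W * 2 ^ p * (2 * (p : ℝ) ^ 2 * Γ + 1) with hϱ
  set A : ℝ := (Fintype.card Λ' : ℝ) * (2 * (p : ℝ) ^ 2 * Γ + 1)⁻¹ with hA
  have hsumw0 : 0 ≤ ∑ s, w s := sum_nonneg fun s _ => hw0 s
  have hW0 : 0 ≤ W := hsumw0.trans hW
  have hsumγ0 : 0 ≤ ∑ z, γ z := sum_nonneg fun z _ => hγ0 z
  have hΓ0 : 0 ≤ Γ := hsumγ0.trans hΓ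
  have hϱ0 : 0 ≤ ϱ := by positivity
  have hA0 : 0 ≤ A := by positivity
  have hq : ϱ * ‖z‖ < 1 := hz
  have hq0 : 0 ≤ ϱ * ‖z‖ := by positivity
  constructor
  · exact (hasSum_partitionFn_pairWord_det β h op om v hh z).unique (hexp z hz)
  · have hgeo : Summable fun j : ℕ => A * (ϱ * ‖z‖) ^ j :=
      (summable_geometric_of_lt_one hq0 hq).mul_left A
    have hle : ∀ j : ℕ, ‖(if j = 0 then 0 else
        orderedIntegral j (wordUrsellIntegrand β h op om v j) 1) * z ^ j‖ ≤ A * (ϱ * ‖z‖) ^ j := by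
      intro j
      by_cases hj0 : j = 0
      · subst hj0; simp only [if_true, pow_zero, mul_one, norm_zero]; exact hA0
      · have hj : 1 ≤ j := Nat.one_le_iff_ne_zero.mpr hj0
        rw [if_neg hj0, norm_mul, norm_pow, mul_pow ϱ ‖z‖ j, ← mul_assoc]
        exact mul_le_mul_of_nonneg_right (hcoef j hj) (pow_nonneg (norm_nonneg _) _)
    calc _ ≤ ∑' j : ℕ, A * (ϱ * ‖z‖) ^ j := tsum_of_norm_bounded hgeo.hasSum hle
      _ = A * ∑' j : ℕ, (ϱ * ‖z‖) ^ j := tsum_mul_left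

/-- **Geometric bound on the restricted connected coefficients** (coefficient extraction): under the
hypotheses of `pairWord_connectedCoeff_bound_and_exp`, for `j ≥ 1` and every set `S` of words of length `j`,
`‖∫_{Δ_j} (-β)^j Σ_{g ∈ S} (∏ v_{g i}) 𝓔ᵀ_j(g) du‖ ≤ |Λ'| (2p²Γ+1)⁻¹ ϱ^j`, `ϱ = e β W 2^p (2p²Γ+1)`.
[cite: BenfattoGiulianiMastropietro2006, (2.77)] -/
theorem norm_wordConnectedCoeffOn_le_geometric (hh : h.IsHermitian) (hβ : 0 ≤ β) (pos : Λ ≃ Λ')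
    (w : T → ℝ) (hw0 : ∀ s, 0 ≤ w s) (hw : ∀ s x, ‖v (s, x)‖ ≤ w s) (W : ℝ) (hW : ∑ s, w s ≤ W)
    (γ : Λ' → ℝ) (hγ0 : ∀ z, 0 ≤ γ z) (hγ : ∀ z, γ (-z) = γ z) (Γ : ℝ) (hΓ : ∑ z, γ z ≤ Γ)
    {j : ℕ} (hj : 1 ≤ j)
    (hG : ∀ (u : Fin j → ℝ), Monotone u → (∀ i, u i ∈ Icc (0 : ℝ) 1) →
      ∀ (t : Fin j → T) (g : Fin j → Λ) (a b : Fin (j * p)),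
        ‖wordPropMatrix β h op om (fun i => (t i, g i)) (fun i => ((u i : ℝ) : ℂ) * -(β : ℂ)) a b‖ ≤
          γ (pos (g (wordCluster p j a)) - pos (g (wordCluster p j b))))
    (S : Finset (Fin j → T × Λ)) :
    ‖orderedIntegral j (fun u : Fin j → ℝ => (-(β : ℂ)) ^ j * ∑ g ∈ S, (∏ i, v (g i)) *
        ursellOf (FermionicTree.moment (wordCluster p j)
          (wordPropMatrix β h op om g (fun i => ((u i : ℝ) : ℂ) * -(β : ℂ)))) univ) 1‖ ≤
      (Fintype.card Λ' : ℝ) * (2 * (p : ℝ) ^ 2 * Γ + 1)⁻¹ *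
        (Real.exp 1 * β * W * 2 ^ p * (2 * (p : ℝ) ^ 2 * Γ + 1)) ^ j :=
  (norm_wordConnectedCoeffOn_le β h op om hh hβ pos γ hγ0 hγ v w hw0 hw hj hG S).trans
    (word_coeff_bound_algebra hβ (sum_nonneg fun s _ => hw0 s) hW (sum_nonneg fun z _ => hγ0 z) hΓ p hj
      (by positivity))

end Main

end Literature.MathematicalPhysics.QuantumLattice
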